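import Summits.MatrixMultiplication.OmegaCensus.STPPKernelListerDescent
import Summits.MatrixMultiplication.OmegaCensus.STPPKernelListerLeaf2

/-!
# ω-census (abelian STPP census): kernel lister — the generic capstone: a certified scan bounds the volume of EVERY STPP family (kernel)

HONEST FRAMING (pub-omega census; verbatim): lottery ticket; floor = certified bounds/negative ranges.
Census STRUCTURE (seat pub-omega-stpp-2 gen 29, 2026-08-29), family (b2).  Nothing here is progress on `ω` — the theorem turns a kernel computation
(`scanFirstC … = true` over certified tables) plus per-pattern kill theorems into «no simultaneous-triple-product family of the finite abelian group `H`
(`|H| = n`) has `Σ |Aᵢ||Bᵢ||Cᵢ| > n`», i.e. CKSU Thm. 5.5 yields no bound below `3` from `H`.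

`volume_le_of_scan`: hypotheses — `|H| = n ≠ 0`; a chunked shape list `L` whose packed tables pass `chunksOK (2n+2)`, listing exactly admissible shapes and
ALL of them; a dead list of non-realisable patterns; a first-block selection covering every listed shape with `scanFirstC n dead sel L = true`.  Conclusion:
every STPP family `(A,B,C) : Fin m → Finset H` has `Σ |Aᵢ||Bᵢ||Cᵢ| ≤ n`.  Assembly of `STPPKernelListerScanSoundH` (search), `…Bound` (tables), `…Real`
/ `…Inv` / `…Leaf` / `…Leaf2` (the `SearchHypH` facts), `…Kit` / `…Descent` (from a family to a bad pattern in list order).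
-/

open Finset

namespace Summit.MatrixMultiplication.OmegaCensus.KLister

open Literature.Computability.AlgebraicComplexity

/-! ## Every admissible shape is listed by `shapeList` -/

/-- Membership in `shapesOfVol`. [folklore] -/
theorem mem_shapesOfVol {n v : ℕ} {s : Shape} (hs : adm n s = true) (hv : svol s = v) : s ∈ shapesOfVol n v := by
  obtain ⟨a, b, c⟩ := s
  have hs' := hs
  rw [adm_iff] at hs'
  obtain ⟨ha, hb, hc, hab, hbc, hca, habc⟩ := hs'
  simp only [pab, pbc, pca, svol] at hab hbc hca habc hv
  simp only [shapesOfVol, List.mem_filter, List.mem_flatMap, List.mem_range, List.mem_map, Bool.and_eq_true, decide_eq_true_eq]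
  refine ⟨⟨a, ?_, b, ?_, c, ?_, rfl⟩, hs, hv⟩
  · nlinarith
  · rw [Nat.max_eq_left ha, Nat.lt_succ_iff, Nat.le_div_iff_mul_le ha]; nlinarith
  · have hab1 : 1 ≤ a * b := Nat.mul_pos ha hb
    rw [Nat.max_eq_left hab1, Nat.lt_succ_iff, Nat.le_div_iff_mul_le hab1]; nlinarith

/-- **Every admissible shape of order `n` is in `shapeList n`.** [folklore] -/
theorem mem_shapeList_of_adm {n : ℕ} {s : Shape} (hs : adm n s = true) : s ∈ shapeList n := by
  have hs' := hs
  rw [adm_iff] at hs'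
  obtain ⟨ha, hb, hc, -, -, -, habc⟩ := hs'
  have hv1 : 1 ≤ svol s := Nat.mul_pos (Nat.mul_pos ha hb) hc
  have hmem : s ∈ shapesOfVol n (svol s - 1 + 1) := mem_shapesOfVol hs (by omega)
  have hrange : svol s - 1 ∈ (List.range n).reverse := by rw [List.mem_reverse, List.mem_range]; omega
  rw [shapeList, List.mem_append]
  by_cases hf : 2 ≤ min s.1 (min s.2.1 s.2.2)
  · left
    rw [List.mem_flatMap]
    exact ⟨_, hrange, List.mem_filter.2 ⟨hmem, by simpa using hf⟩⟩
  · right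
    rw [List.mem_flatMap]
    refine ⟨_, hrange, List.mem_filter.2 ⟨hmem, ?_⟩⟩
    exact decide_eq_true (by rw [decide_eq_true_eq]; exact hf)

/-! ## The generic capstone -/

variable {H : Type*} [AddCommGroup H] [Fintype H] [DecidableEq H] {n : ℕ}

/-- **The `SearchHypH` instance** for a finite abelian group of order `n ≠ 0`, the universe of admissible shapes `U`, and a dead list of non-realisable
patterns. [folklore] -/
theorem searchHypH_inst (hn : Fintype.card H = n) (hn0 : n ≠ 0) {dead : List (List Shape)} (hdead : ∀ D ∈ dead, ¬ Realizable H D)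
    {U : List Shape} (hU : ∀ s ∈ U, adm n s = true) :
    SearchHypH n dead U (Bad n H) (Inv n) (CovC (2 * n + 2)) where
  nonbeating := fun _ _ hI hv => nonbeating_inst hI hv
  misfit := fun _ _ _ _ _ hI h => misfit_inst hn hI h
  overshoot := fun _ _ _ _ _ hI h => overshoot_inst hI h
  exhausted := fun _ _ _ _ hs hI h => exhausted_inst hn (hU _ hs) hI h
  leaf := fun _ _ hI _ h => leaf_inst hn hn0 hdead hI h
  prefix_beating := fun _ _ _ hI hv hE => prefix_beating_inst hI hv hE
  prune := fun _ _ _ _ _ hI hh hcov hE hb => prune_inst hn hI hh hcov hE hb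
  add := fun _ _ _ hs hI _ => add_inst (hU _ hs) hI
  cov_tail := fun _ _ _ h => h.tail

/-- **Generic capstone: a certified scan bounds the volume of every STPP family of `H`.** [cite: CohnKleinbergSzegedyUmans2005, Def. 5.1, Thm. 5.5] -/
theorem volume_le_of_scan (hn : Fintype.card H = n) (hn0 : n ≠ 0) (L : List (List ℕ × List Shape)) (dead : List (List Shape)) (sel : Shape → Bool)
    (hdead : ∀ D ∈ dead, ¬ Realizable H D) (hcert : chunksOK (2 * n + 2) L = true) (hadm : ∀ s ∈ flat L, adm n s = true)
    (hall : ∀ s, adm n s = true → s ∈ flat L) (hsel : ∀ s ∈ flat L, sel s = true) (hscan : scanFirstC n dead sel L = true)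
    {m : ℕ} (A B C : Fin m → Finset H) (hS : IsSTPP A B C) : ∑ i, #(A i) * #(B i) * #(C i) ≤ n := by
  by_contra hlt
  rw [not_le] at hlt
  -- a realisable beating pattern, then a bad one
  obtain ⟨P, hP, hvol⟩ := realizable_of_isSTPP A B C hS
  obtain ⟨Q, hQ⟩ := exists_bad_of_beating hn ⟨P, hP, by rw [hvol]; exact hlt⟩
  -- reorder it into list order
  have hQU : ∀ e ∈ Q, e ∈ flat L := fun e he => hall e (by have := hQ.1.adm e he; rwa [hn] at this)
  obtain ⟨E, hperm, hord⟩ := exists_perm_ordExt (flat L) Q hQU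
  have hE : Bad n H E := hQ.perm hperm
  -- `E` is non-empty: its first block is listed, hence selected
  obtain ⟨s, E', hEs⟩ : ∃ s E', E = s :: E' := by
    cases hE' : E with
    | nil => exfalso; have := hE.2.1; rw [hE'] at this; simp [sumVol] at this
    | cons s E' => exact ⟨s, E', rfl⟩
  have hs : s ∈ flat L := hord.mem s (by rw [hEs]; exact List.mem_cons_self)
  -- the certified scan excludes it
  have H := searchHypH_inst hn hn0 hdead hadm
  have hinit : Inv n (St.init n) [] := ⟨rfl, fun _ h => by simp at h⟩
  exact scanFirstC_soundH H hinit L (fun x hx => hx) (chunksCov_of_chunksOK hcert) hscan E hord s E' hEs (hsel s hs) hE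

end Summit.MatrixMultiplication.OmegaCensus.KLister
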